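import Literature.Probability.RandomPlanarGeometry.HexSAWBrickWallStrip
import HarnessLib

/-!
# Self-avoiding walks of the honeycomb lattice in a COLUMN SLAB of the brick wall (the perpendicular / armchair family):
# the counts `c_N(Slab_H)`, `c_{N+M}(Slab_H) ≤ c_N(Slab_H) c_M(Slab_H)`, and the slab connective constant `μ(Slab_H)`

Topic `Literature/Probability/RandomPlanarGeometry` (the coordinate-0 twin of `HexSAWBrickWallStrip.lean`, which treats the ROW
strips `S_T = ℤ × {0,…,T}` = `{0 ≤ x₁ ≤ T}`).  Here

  `Slab_H = {0, 1, …, H} × ℤ`   (`0 ≤ x₀ ≤ H`: `H + 1` columns of sites, unbounded in the coordinate `x₁`),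

the slabs bounded in the HEIGHT coordinate of the tree's brick-wall bridges (`HexSAWBrickWallBridges`: heights are `x₀`), i.e. the
family perpendicular to the row strips.  FRAME / INDEX CONVENTION: these are the strips of Beaton's ROTATED («armchair») honeycomb
lattice (N. R. Beaton, *J. Phys. A* 47 (2014), arXiv:1210.0274v3, §2 Fig. 1 and §3.2: walks confined to a strip of height `T`, heights
`ξ`): through `ρ⁻¹` and the chart `hvToBW` (`ht = x₀ = −ξ`, `HexSAWRotStripDictionary.xi_rho`) Beaton's slab `{1 ≤ −ξ ≤ T}` is the
column range `x₀ ∈ {1,…,T}` of `Slab_T` — so every statement below about `Slab_H = {0 ≤ x₀ ≤ H}` is Beaton's up to the index shift by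
one column (the transfer itself is `HexSAWRotSlabSummable.lean`; nothing here uses it).  PRINTED TWINS at `y = 1`: Beaton 2014 §3.2
Propositions 8–9 and Corollary 10 (arXiv v3 p. 15: `μ_T(1,y) < μ_{T+1}(1,y) → κ(y)`, radius `ρ_T(y) = 1/μ_{T−1}(1,y) ↓ x_c` — proof by
reference to BBdGDCG14 Proposition 7, unfolded arches; not the proof formalised in this chain) and, for `ℤ^d` tubes, Madras–Slade
(8.2.11)–(8.2.13) p. 269.
Source of the STATEMENTS transplanted: N. Madras, G. Slade, *The Self-Avoiding Walk* (1993), §8.2, (8.2.1)–(8.2.3), pp. 267–268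
(tubes/slabs `R[k,T]` of `ℤ^d`: `S_N(R)`, `c_N(R)`, `c_{N+M}(R) ≤ c_N(R) c_M(R)`, `μ(R) = lim c_N(R)^{1/N} = inf c_N(R)^{1/N}`).

## The translation group of a column slab

The brick wall is invariant under the translation by `t` iff `t₀ + t₁` is even, so the translations of `Slab_H` along itself are
generated by `x ↦ x + (0,2)`, and "walks in `Slab_H` up to translation" are the walks starting in the cross-section
`{0,…,H} × {0,1}` (`slabStarts H`, `2(H+1)` sites); a walk is encoded by the pair `(a, υ)` of its starting site and its translate
`υ ∈ Zd.saws 2 N` started at the origin, the brick-wall condition being imposed on the PLACED walk `i ↦ a + υ i`.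

## Contents (namespace `Literature.Probability.RandomPlanarGeometry.SAW.HexBW`, all PROVED)

* `InSlab H x`, `slabStarts H`, `slabPairs H N ≃ S_N(Slab_H)`, `slabCount H N = c_N(Slab_H)`,
  `slabConnectiveConstant H = μ(Slab_H) = inf_{N ≥ 1} c_N(Slab_H)^{1/N}`;
* `one_le_slabCount` (`H ≥ 1`: the two-column zigzag `zigzagWalk`), `slabCount_le` (`c_N(Slab_H) ≤ 2(H+1) · c_N(ℍ)`), `slabCount_mono`;
* **`slabCount_add_le`** — `c_{N+M}(Slab_H) ≤ c_N(Slab_H) c_M(Slab_H)` (the second piece translated back by an EVEN vertical vector);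
* **`tendsto_slabCount_rpow`** — `c_N(Slab_H)^{1/N} → μ(Slab_H)` (Fekete, `H ≥ 1`), `slabConnectiveConstant_le_rpow`,
  `one_le_slabConnectiveConstant`, `slabConnectiveConstant_mono` and `slabConnectiveConstant_le` (`μ(Slab_H) ≤ μ_ℍ`).

Lane «pcv-sawmu» door R100 «HEX-ARMCHAIR-SLAB-SUBCRIT» (a-p5 g7 design: double-row insertion ⇒ `μ(Slab_H) < μ(Slab_{H+1})`), file 1.
-/

noncomputable section

open Filter Topology Finset Literature.Probability.LatticeModels Literature.Probability.Percolation SimpleGraph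

namespace Literature.Probability.RandomPlanarGeometry.SAW.HexBW

/-! ### The strip `Slab_H`, starting sites, and `S_N(Slab_H)` -/

/-- Membership in the row strip `Slab_H = ℤ × {0,…,H}` of the brick wall: `0 ≤ x₁ ≤ H`.
[cite: MadrasSlade1993, §8.2, eq. (8.2.1)] -/
def InSlab (H : ℕ) (x : Site 2) : Prop := 0 ≤ x 0 ∧ x 0 ≤ (H : ℤ)

/-- The starting sites of the walks of `S_N(Slab_H)`: the cross-section `{0,1} × {0,…,H}` (one site per orbit
of the translation group `⟨x ↦ x + 2⟩` of the strip on each row). [cite: MadrasSlade1993, §8.2, eq. (8.2.1)] -/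
def slabStarts (H : ℕ) : Finset (Site 2) :=
  Fintype.piFinset fun i : Fin 2 => if i = 0 then Finset.Icc (0 : ℤ) H else Finset.Icc (0 : ℤ) 1

open Classical in
/-- `S_N(Slab_H)`, the `N`-step self-avoiding walks of the honeycomb lattice (brick wall) in `Slab_H` starting in the
cross-section, encoded as pairs `(a, υ)` = (starting site, translate started at the origin): `a ∈ slabStarts H`,
`υ ∈ Zd.saws 2 N`, the placed walk `i ↦ a + υ i` uses brick-wall bonds and stays in `Slab_H`.
[cite: MadrasSlade1993, §8.2] -/
def slabPairs (H N : ℕ) : Finset (Site 2 × (ℕ → Site 2)) :=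
  (slabStarts H ×ˢ Zd.saws 2 N).filter fun p =>
    IsBW N (fun i => p.1 + p.2 i) ∧ ∀ m ≤ N, InSlab H (p.1 + p.2 m)

/-- `c_N(Slab_H) = |S_N(Slab_H)|`, the number of `N`-step self-avoiding walks of `ℍ` in the strip `Slab_H` up to the
translations of the strip. [cite: MadrasSlade1993, §8.2] -/
def slabCount (H N : ℕ) : ℕ :=
  (slabPairs H N).card

/-- The strip connective constant `μ(Slab_H) = inf_{N ≥ 1} c_N(Slab_H)^{1/N}` (equal to `lim c_N(Slab_H)^{1/N}`,
`tendsto_slabCount_rpow`). [cite: MadrasSlade1993, §8.2, eq. (8.2.3)] -/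
def slabConnectiveConstant (H : ℕ) : ℝ :=
  ⨅ n : ℕ, (slabCount H (n + 1) : ℝ) ^ (1 / ((n : ℝ) + 1))

/-! ### Bookkeeping -/

/-- Membership in `slabStarts`. [cite: MadrasSlade1993, §8.2, eq. (8.2.1)] -/
theorem mem_slabStarts {H : ℕ} {a : Site 2} :
    a ∈ slabStarts H ↔ InSlab H a ∧ (0 ≤ a 1 ∧ a 1 ≤ 1) := by
  rw [slabStarts, Fintype.mem_piFinset, Fin.forall_fin_two, if_pos rfl,
    if_neg (by decide : (1 : Fin 2) ≠ 0), Finset.mem_Icc, Finset.mem_Icc]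
  rfl

/-- `#slabStarts H = 2(H+1)`. [cite: MadrasSlade1993, §8.2, eq. (8.2.1)] -/
theorem card_slabStarts (H : ℕ) : (slabStarts H).card = 2 * (H + 1) := by
  rw [slabStarts, Fintype.card_piFinset, Fin.prod_univ_two, if_pos rfl,
    if_neg (by decide : (1 : Fin 2) ≠ 0), Int.card_Icc, Int.card_Icc]
  simp; ring

/-- The origin is a starting site. [cite: MadrasSlade1993, §8.2, eq. (8.2.1)] -/
theorem zero_mem_slabStarts (H : ℕ) : (0 : Site 2) ∈ slabStarts H :=
  mem_slabStarts.2 ⟨⟨le_rfl, by positivity⟩, le_rfl, by norm_num⟩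

/-- `Slab_H ⊆ Slab_{H'}` for `H ≤ H'`. [cite: MadrasSlade1993, §8.2, eq. (8.2.1)] -/
theorem InSlab.mono {H H' : ℕ} (hH : H ≤ H') {x : Site 2} (h : InSlab H x) : InSlab H' x :=
  ⟨h.1, h.2.trans (by exact_mod_cast hH)⟩

/-- Starting sites are monotone in `H`. [cite: MadrasSlade1993, §8.2, eq. (8.2.1)] -/
theorem slabStarts_mono {H H' : ℕ} (hH : H ≤ H') : slabStarts H ⊆ slabStarts H' := by
  intro a ha
  rw [mem_slabStarts] at ha ⊢
  exact ⟨ha.1.mono hH, ha.2⟩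

/-- Membership in `slabPairs`. [cite: MadrasSlade1993, §8.2] -/
theorem mem_slabPairs {H N : ℕ} {p : Site 2 × (ℕ → Site 2)} :
    p ∈ slabPairs H N ↔
      p.1 ∈ slabStarts H ∧ p.2 ∈ Zd.saws 2 N ∧ IsBW N (fun i => p.1 + p.2 i) ∧
        ∀ m ≤ N, InSlab H (p.1 + p.2 m) := by
  classical
  simp only [slabPairs, Finset.mem_filter, Finset.mem_product, and_assoc]

/-! ### Elementary bounds and monotonicity -/

/-- `c_N(Slab_H) ≤ c_N(Slab_{H'})` for `H ≤ H'` (more room). [cite: MadrasSlade1993, §8.2] -/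
theorem slabCount_mono {H H' : ℕ} (hH : H ≤ H') (N : ℕ) : slabCount H N ≤ slabCount H' N := by
  refine Finset.card_le_card fun p hp => ?_
  rw [mem_slabPairs] at hp ⊢
  exact ⟨slabStarts_mono hH hp.1, hp.2.1, hp.2.2.1, fun m hm => (hp.2.2.2 m hm).mono hH⟩

/-- **`c_N(Slab_H) ≤ 2(H+1) · c_N(ℍ)`**: reading the placed walk back from its starting site with the parity
twist (`(a, υ) ↦ (a, twistAt a ∘ υ)`) is an injection into `slabStarts H × HexBW.saws N`.
[cite: MadrasSlade1993, §8.2] -/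
theorem slabCount_le (H N : ℕ) : slabCount H N ≤ 2 * (H + 1) * hexSawCount N := by
  classical
  rw [slabCount, ← card_slabStarts, ← card_saws, ← Finset.card_product]
  refine Finset.card_le_card_of_injOn (fun p => (p.1, fun i => twistAt p.1 (p.2 i))) ?_ ?_
  · rintro ⟨a, ω⟩ hp
    rw [Finset.mem_coe, mem_slabPairs] at hp
    obtain ⟨ha, hω, hbw, -⟩ := hp
    rw [Finset.mem_coe, Finset.mem_product]
    refine ⟨ha, mem_saws.2 ⟨twistAt_comp_mem_zdSaws a hω, fun i hi => ?_⟩⟩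
    have key := hbw i hi
    rw [← adj_add_twistAt_iff a, twistAt_twistAt, twistAt_twistAt]
    exact key
  · rintro ⟨a, ω⟩ - ⟨a', ω'⟩ - h
    simp only [Prod.mk.injEq] at h ⊢
    obtain ⟨rfl, h2⟩ := h
    exact ⟨rfl, funext fun i => twistAt_injective a (congrFun h2 i)⟩

/-- The two-column zigzag `(0,0),(0,1),(1,1),(1,2),(0,2),(0,3),(1,3),…` of the brick wall (an infinite self-avoiding
walk of `Slab_1`), frozen after time `N`. [cite: MadrasSlade1993, §8.2] -/
def zigzagWalk (N : ℕ) : ℕ → Site 2 := fun t => ![(((min t N : ℕ) : ℤ) % 4) / 2, (((min t N : ℕ) : ℤ) + 1) / 2]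

/-- Coordinates of the zigzag. [cite: MadrasSlade1993, §8.2] -/
theorem zigzagWalk_apply_zero (N t : ℕ) : zigzagWalk N t 0 = (((min t N : ℕ) : ℤ) % 4) / 2 := rfl

/-- Coordinates of the zigzag. [cite: MadrasSlade1993, §8.2] -/
theorem zigzagWalk_apply_one (N t : ℕ) : zigzagWalk N t 1 = (((min t N : ℕ) : ℤ) + 1) / 2 := rfl

/-- The zigzag is a brick-wall self-avoiding walk of `Slab_H`, `H ≥ 1`, from the origin: `c_N(Slab_H) ≥ 1`.
[cite: MadrasSlade1993, §8.2] -/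
theorem one_le_slabCount {H : ℕ} (hH : 1 ≤ H) (N : ℕ) : 1 ≤ slabCount H N := by
  have hbw : ∀ i < N, brickWallGraph.Adj (zigzagWalk N i) (zigzagWalk N (i + 1)) := by
    intro i hi
    rw [brickWallGraph_adj_coord, zigzagWalk_apply_zero, zigzagWalk_apply_zero, zigzagWalk_apply_one,
      zigzagWalk_apply_one, Nat.min_eq_left hi.le, Nat.min_eq_left (by omega : i + 1 ≤ N)]
    push_cast
    omega
  refine Finset.card_pos.2 ⟨(0, zigzagWalk N), mem_slabPairs.2
    ⟨zero_mem_slabStarts H, Zd.mem_saws.2 ⟨?_, fun i hi => ?_, fun i hi => zd_adj_of_adj (hbw i hi), ?_⟩,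
      fun i hi => by simpa only [zero_add] using hbw i hi, fun m _ => ?_⟩⟩
  · ext j
    fin_cases j <;> simp [zigzagWalk]
  · ext j
    fin_cases j <;> simp [zigzagWalk, Nat.min_eq_right hi]
  · intro i hi j hj hij
    simp only [Set.mem_setOf_eq] at hi hj
    dsimp only at hij
    have h0 := congrFun hij 0
    have h1 := congrFun hij 1
    rw [zigzagWalk_apply_zero, zigzagWalk_apply_zero, Nat.min_eq_left hi, Nat.min_eq_left hj] at h0
    rw [zigzagWalk_apply_one, zigzagWalk_apply_one, Nat.min_eq_left hi, Nat.min_eq_left hj] at h1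
    omega
  · simp only [zero_add, InSlab, zigzagWalk_apply_zero]
    constructor <;> omega

/-! ### Submultiplicativity `c_{N+M}(Slab_H) ≤ c_N(Slab_H) c_M(Slab_H)` (8.2.2) -/

/-- The cross-section representative of a site: `(x₀, x₁ mod 2)`. [cite: MadrasSlade1993, §8.2] -/
def vnorm (z : Site 2) : Site 2 := fun i => if i = 0 then z 0 else z i % 2

/-- Coordinates of `vnorm`. [cite: MadrasSlade1993, §8.2] -/
@[simp] theorem vnorm_apply_zero (z : Site 2) : vnorm z 0 = z 0 := rfl

/-- Coordinates of `vnorm`. [cite: MadrasSlade1993, §8.2] -/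
@[simp] theorem vnorm_apply_one (z : Site 2) : vnorm z 1 = z 1 % 2 := if_neg (by decide)

/-- `vnorm` of a site of `Slab_H` is a starting site. [cite: MadrasSlade1993, §8.2, eq. (8.2.1)] -/
theorem vnorm_mem_slabStarts {H : ℕ} {z : Site 2} (hz : InSlab H z) : vnorm z ∈ slabStarts H := by
  refine mem_slabStarts.2 ⟨⟨?_, ?_⟩, ?_, ?_⟩
  · rw [vnorm_apply_zero]; exact hz.1
  · rw [vnorm_apply_zero]; exact hz.2
  · rw [vnorm_apply_one]; omega
  · rw [vnorm_apply_one]; omega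

/-- The translation `z − vnorm z` is vertical and even. [cite: MadrasSlade1993, §8.2] -/
theorem vnorm_shift_even (z : Site 2) : ((z - vnorm z) 0 + (z - vnorm z) 1) % 2 = 0 := by
  simp only [Pi.sub_apply, vnorm_apply_zero, vnorm_apply_one, sub_self, zero_add]
  omega

/-- **`c_{N+M}(Slab_H) ≤ c_N(Slab_H) · c_M(Slab_H)`**: "both the first `N` steps and the last `M` steps of `ω` are
also self-avoiding walks in `Slab_H`" — the last `M` steps translated by the EVEN vertical vector that puts
their start into the cross-section; the splitting is injective. [cite: MadrasSlade1993, §8.2, eq. (8.2.2)] -/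
theorem slabCount_add_le (H N M : ℕ) :
    slabCount H (N + M) ≤ slabCount H N * slabCount H M := by
  classical
  rw [slabCount, slabCount, slabCount, ← Finset.card_product]
  refine Finset.card_le_card_of_injOn
    (fun p => ((p.1, fun i => p.2 (min i N)),
      (vnorm (p.1 + p.2 N), fun i => p.2 (N + min i M) - p.2 N))) ?_ ?_
  · rintro ⟨a, ω⟩ hp
    rw [Finset.mem_coe, mem_slabPairs] at hp
    obtain ⟨ha, hω, hbw, hR⟩ := hp
    obtain ⟨h0, hend, hadj, hinj⟩ := Zd.mem_saws.1 hω
    rw [Finset.mem_coe, Finset.mem_product, mem_slabPairs, mem_slabPairs]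
    refine ⟨⟨ha, Zd.mem_saws.2 ⟨by simpa using h0, ?_, ?_, ?_⟩, ?_, ?_⟩,
      vnorm_mem_slabStarts (hR N (Nat.le_add_right N M)), Zd.mem_saws.2 ⟨by simp, ?_, ?_, ?_⟩, ?_, ?_⟩
    · intro i hi
      simp [min_eq_right hi]
    · intro i hi
      have h1 : min i N = i := min_eq_left hi.le
      have h2 : min (i + 1) N = i + 1 := min_eq_left (by omega)
      simp only [h1, h2]
      exact hadj i (by omega)
    · intro i hi j hj hij
      simp only [Set.mem_setOf_eq] at hi hj
      simp only [min_eq_left hi, min_eq_left hj] at hij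
      exact hinj (by simp only [Set.mem_setOf_eq]; omega)
        (by simp only [Set.mem_setOf_eq]; omega) hij
    · intro i hi
      have h1 : min i N = i := min_eq_left hi.le
      have h2 : min (i + 1) N = i + 1 := min_eq_left (by omega)
      simp only [h1, h2]
      exact hbw i (by omega)
    · intro m hm
      simp only [min_eq_left hm]
      exact hR m (by omega)
    · intro i hi
      simp [min_eq_right hi]
    · intro i hi
      have h1 : min i M = i := min_eq_left hi.le
      have h2 : min (i + 1) M = i + 1 := min_eq_left (by omega)
      simp only [h1, h2]
      rw [Zd.zdGraph_adj_sub_right, ← add_assoc]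
      exact hadj (N + i) (by omega)
    · intro i hi j hj hij
      simp only [Set.mem_setOf_eq] at hi hj
      simp only [min_eq_left hi, min_eq_left hj, sub_left_inj] at hij
      have := hinj (by simp only [Set.mem_setOf_eq]; omega)
        (by simp only [Set.mem_setOf_eq]; omega) hij
      omega
    · intro i hi
      have h1 : min i M = i := min_eq_left hi.le
      have h2 : min (i + 1) M = i + 1 := min_eq_left (by omega)
      simp only [h1, h2]
      have key : brickWallGraph.Adj (a + ω (N + i)) (a + ω (N + i + 1)) := hbw (N + i) (by omega)
      have e1 : a + ω N - vnorm (a + ω N) + (vnorm (a + ω N) + (ω (N + i) - ω N)) =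
          a + ω (N + i) := by abel
      have e2 : a + ω N - vnorm (a + ω N) + (vnorm (a + ω N) + (ω (N + (i + 1)) - ω N)) =
          a + ω (N + i + 1) := by rw [← add_assoc N i 1]; abel
      rw [← adj_add_left_iff_of_even (vnorm_shift_even (a + ω N)), e1, e2]
      exact key
    · intro m hm
      simp only [min_eq_left hm]
      have hin := hR (N + m) (by omega)
      refine ⟨?_, ?_⟩
      · have := hin.1
        simp only [Pi.add_apply, Pi.sub_apply, vnorm_apply_zero] at this ⊢
        linarith
      · have := hin.2
        simp only [Pi.add_apply, Pi.sub_apply, vnorm_apply_zero] at this ⊢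
        linarith
  · rintro ⟨a, ω⟩ hp ⟨a', ω'⟩ hp' h
    rw [Finset.mem_coe, mem_slabPairs] at hp hp'
    dsimp only at hp hp'
    have hω := Zd.mem_saws.1 hp.2.1
    have hω' := Zd.mem_saws.1 hp'.2.1
    simp only [Prod.mk.injEq] at h
    obtain ⟨⟨rfl, h1⟩, -, h2⟩ := h
    simp only [Prod.mk.injEq, true_and]
    have hn : ω N = ω' N := by simpa using congrFun h1 N
    funext i
    rcases le_or_gt i N with hi | hi
    · simpa [min_eq_left hi] using congrFun h1 i
    · obtain ⟨j, rfl⟩ : ∃ j, i = N + j := ⟨i - N, by omega⟩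
      rcases le_or_gt j M with hj | hj
      · have := congrFun h2 j
        simp only [min_eq_left hj] at this
        rwa [hn, sub_left_inj] at this
      · have := congrFun h2 M
        simp only [min_self] at this
        rw [hn, sub_left_inj] at this
        rw [hω.2.1 (N + j) (by omega), hω'.2.1 (N + j) (by omega), this]

/-! ### `c_N(Slab_H)^{1/N} → μ(Slab_H) = inf_N c_N(Slab_H)^{1/N}` (8.2.3) -/

/-- `μ(Slab_H) ≤ c_N(Slab_H)^{1/N}` for `N ≥ 1` (definition of `μ(Slab_H)` as an infimum).
[cite: MadrasSlade1993, §8.2, eq. (8.2.3)] -/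
theorem slabConnectiveConstant_le_rpow (H : ℕ) {n : ℕ} (hn : n ≠ 0) :
    slabConnectiveConstant H ≤ (slabCount H n : ℝ) ^ (1 / (n : ℝ)) := by
  obtain ⟨m, rfl⟩ := Nat.exists_eq_succ_of_ne_zero hn
  have hb : BddBelow (Set.range fun m : ℕ => (slabCount H (m + 1) : ℝ) ^ (1 / ((m : ℝ) + 1))) :=
    ⟨0, by rintro _ ⟨m, rfl⟩; exact Real.rpow_nonneg (Nat.cast_nonneg _) _⟩
  have := ciInf_le hb m
  simpa [slabConnectiveConstant, Nat.cast_succ] using this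

/-- `μ(Slab_H) ≤ μ(Slab_{H'})` for `H ≤ H'`: the strip constant is nondecreasing in the width.
[cite: MadrasSlade1993, §8.2, proof of Theorem 8.2.1] -/
theorem slabConnectiveConstant_mono {H H' : ℕ} (hH : H ≤ H') :
    slabConnectiveConstant H ≤ slabConnectiveConstant H' := by
  refine le_ciInf fun n => ?_
  refine (slabConnectiveConstant_le_rpow H (Nat.succ_ne_zero n)).trans ?_
  rw [Nat.cast_succ]
  exact Real.rpow_le_rpow (Nat.cast_nonneg _) (by exact_mod_cast slabCount_mono hH (n + 1)) (by positivity)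

/-- **`c_N(Slab_H)^{1/N} → μ(Slab_H)`**: `log c_N(Slab_H)` is subadditive by (8.2.2), so Fekete's lemma
(Madras–Slade Lemma 1.2.2, Mathlib `Subadditive.tendsto_lim`) gives convergence of `N⁻¹ log c_N(Slab_H)` to its
infimum; `μ(Slab_H)` is *defined* as `inf_N c_N(Slab_H)^{1/N}`. [cite: MadrasSlade1993, §8.2, eq. (8.2.3)] -/
theorem tendsto_slabCount_rpow {H : ℕ} (hH : 1 ≤ H) :
    Tendsto (fun n : ℕ => (slabCount H n : ℝ) ^ (1 / (n : ℝ))) atTop (𝓝 (slabConnectiveConstant H)) := by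
  have hpos : ∀ n, (0 : ℝ) < slabCount H n := fun n => by exact_mod_cast one_le_slabCount hH n
  have hu : Subadditive fun n => Real.log (slabCount H n) := by
    intro m n
    rw [← Real.log_mul (hpos m).ne' (hpos n).ne']
    apply Real.log_le_log (hpos _)
    exact_mod_cast slabCount_add_le H m n
  have hbdd : BddBelow (Set.range fun n : ℕ => Real.log (slabCount H n) / n) := by
    refine ⟨0, ?_⟩
    rintro _ ⟨n, rfl⟩
    exact div_nonneg (Real.log_nonneg (by exact_mod_cast one_le_slabCount hH n)) (Nat.cast_nonneg n)
  have hlim := hu.tendsto_lim hbdd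
  have key : ∀ n : ℕ, (slabCount H n : ℝ) ^ (1 / (n : ℝ)) = Real.exp (Real.log (slabCount H n) / n) :=
    fun n => by rw [Real.rpow_def_of_pos (hpos n), mul_one_div]
  have hexp : Tendsto (fun n : ℕ => Real.exp (Real.log (slabCount H n) / n)) atTop (𝓝 (Real.exp hu.lim)) :=
    (Real.continuous_exp.tendsto _).comp hlim
  have heq : (fun n : ℕ => (slabCount H n : ℝ) ^ (1 / (n : ℝ))) =
      fun n => Real.exp (Real.log (slabCount H n) / n) := funext key
  rw [heq]
  convert hexp using 2
  apply le_antisymm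
  · refine ge_of_tendsto hexp ?_
    filter_upwards [eventually_ge_atTop 1] with n hn
    rw [← key n]
    obtain ⟨m, rfl⟩ := Nat.exists_eq_succ_of_ne_zero (by omega : n ≠ 0)
    have hb : BddBelow (Set.range fun m : ℕ => (slabCount H (m + 1) : ℝ) ^ (1 / ((m : ℝ) + 1))) :=
      ⟨0, by rintro _ ⟨m, rfl⟩; exact Real.rpow_nonneg (Nat.cast_nonneg _) _⟩
    have := ciInf_le hb m
    simpa [slabConnectiveConstant, Nat.cast_succ] using this
  · refine le_ciInf fun n => ?_
    have h1 := hu.lim_le_div hbdd (Nat.succ_ne_zero n)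
    have h2 := Real.exp_le_exp.2 h1
    rw [← key (n + 1)] at h2
    simpa [Nat.cast_succ] using h2

/-- `1 ≤ μ(Slab_H)`. [cite: MadrasSlade1993, §8.2] -/
theorem one_le_slabConnectiveConstant {H : ℕ} (hH : 1 ≤ H) : 1 ≤ slabConnectiveConstant H :=
  le_ciInf fun n => Real.one_le_rpow (by exact_mod_cast one_le_slabCount hH (n + 1)) (by positivity)

/-- `0 < μ(Slab_H)`. [cite: MadrasSlade1993, §8.2] -/
theorem slabConnectiveConstant_pos {H : ℕ} (hH : 1 ≤ H) : 0 < slabConnectiveConstant H :=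
  one_pos.trans_le (one_le_slabConnectiveConstant hH)

/-- **`μ(Slab_H) ≤ μ_ℍ`**: `c_N(Slab_H) ≤ 2(H+1) · c_N(ℍ)`, so `c_N(Slab_H)^{1/N} ≤ (2(H+1))^{1/N} c_N(ℍ)^{1/N} → μ_ℍ`.
[cite: MadrasSlade1993, §8.2, eq. (8.2.11)] -/
theorem slabConnectiveConstant_le {H : ℕ} (hH : 1 ≤ H) : slabConnectiveConstant H ≤ hexConnectiveConstant := by
  set S : ℝ := (2 * ((H : ℝ) + 1)) with hS
  have hS1 : 1 ≤ S := by rw [hS]; have : (0 : ℝ) ≤ H := Nat.cast_nonneg _; linarith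
  -- `S^{1/n} → 1`
  have hS' : Tendsto (fun n : ℕ => S ^ (1 / (n : ℝ))) atTop (𝓝 1) := by
    have h1 : Tendsto (fun n : ℕ => Real.log S / (n : ℝ)) atTop (𝓝 0) :=
      tendsto_const_div_atTop_nhds_zero_nat _
    have h2 := (Real.continuous_exp.tendsto _).comp h1
    rw [Real.exp_zero] at h2
    refine h2.congr fun n => ?_
    rw [Function.comp_apply, Real.rpow_def_of_pos (by linarith), mul_one_div]
  have hlim : Tendsto (fun n : ℕ => S ^ (1 / (n : ℝ)) * (hexSawCount n : ℝ) ^ (1 / (n : ℝ))) atTop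
      (𝓝 hexConnectiveConstant) := by
    have := hS'.mul tendsto_hexSawCount_rpow
    rwa [one_mul] at this
  refine le_of_tendsto_of_tendsto (tendsto_slabCount_rpow hH) hlim ?_
  filter_upwards [eventually_ge_atTop 1] with n hn
  have h0 : (0 : ℝ) ≤ slabCount H n := Nat.cast_nonneg _
  rw [← Real.mul_rpow (by linarith) (Nat.cast_nonneg _)]
  refine Real.rpow_le_rpow h0 ?_ (by positivity)
  rw [hS]
  exact_mod_cast slabCount_le H n

end Literature.Probability.RandomPlanarGeometry.SAW.HexBW
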